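import Summits.QuantumFields.YangMills.Theorems.UnitScaleTiltProp7SymCentreAbelianFibre
import Summits.QuantumFields.YangMills.Theorems.AlphaInputsT3ACv3AbelianRegion
import HarnessLib

/-!
# Route `UnitScaleTilt`, crux K1 child «MinimiserStabilityRegPr» (stmt-QuantumFields-19200), stub `stub_existenceMinimalOrbit` (EX), route (α), line «SYM-CENTRE»
# (★★OWNER RULING g28-№7 cure (ii-a); px20 g2 row (R4), word «w4-20520 g9: R4-FIBRE GO») — **R4-FIBRE, REGIONAL FORM: the descent of an abelian configuration whose curls are
# small only UNDER a nested region (e.g. off the Dirac strings of a flux cochain), pointwise at the coarse bonds under the region**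

Cell `ym3-torus`, width seat `ym-ust-20520-w4` (gen 9).  THEOREMS ONLY (0 `def`, 0 `sorry`).  `--supports stmt-QuantumFields-19200 --as helper`, count-neutral.
YM₃ on T³ is a ladder rung (R3), not the Clay problem; nothing here claims the stub, the crux, d = 4 or the mass gap.

THE POINT.  Sibling of ✓`Prop7SymCentreAbelianFibre` (global curl guard ∕ loop-sum guards).  Here the curl of the finest one-form `a` is `≤ B` only on the unit squares with four corners
in `R 0`, `R` a nested family of site sets of run `K` (`z ∈ R i ↔ blockOf z ∈ R (i+1)`); ★alpha-2's two-block-exact regional theorem ✓`AbelianEML.iter_blockAvg_gexpAt_region` then gives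
the printed `exp[mean log]` descent POINTWISE at every coarse bond whose identified bond `ĉ = bondShift (sites_eq F n K h) c` has both endpoints in `R (K − n)`; the gauge-covariant
reading (`descendTo (u • U_a) c = (u↓ • V_θ) c`) follows from ✓`descendTo_gaugeAct`.  Use: string-relocation patches of the flux sector (two placements cover all coarse bonds; the field
is unchanged by `2π·ℤ`-cochains, ✓`gexpAt_I_smul_sigma3_add_two_pi_mul_int`).
* §1 (any `SU(N)`, any direction `Y`) ★★ `descendTo_gexpAt_apply_of_region`, `descendTo_gexpAt_apply_eq_of_region`, `descendTo_gaugeAct_gexpAt_apply_eq_of_region`.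
* §2 (T³, `ℰp`, `SU(2)`, `iσ₃`, window `30·L²·(L²)^{K−n}·B ≤ 1`) ★★ `descendTo_diag_apply_eq_T3`, `descendTo_gaugeAct_diag_apply_eq_T3`.
HONEST SCOPE.  Kernel bookkeeping over ★alpha-2's regional abelian `exp[mean log]` theorem and the descent's definition; no estimate of [7]∕[4]; nothing of EX∕the crux∕`hSymCentre` is
proved or claimed.

References: T. Bałaban, CMP 109 (1987) [Balaban1987RG1] ((0.4), (0.11) p.253); CMP 98 (1985) [Balaban1985Averaging] ((11)–(12), (19)–(20) pp.19–21); CMP 102 (1985) [Balaban1985Variational] ((2)–(4) p.278).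
-/

set_option autoImplicit false

noncomputable section

open scoped BigOperators Matrix.Norms.L2Operator Matrix

namespace Summit.QuantumFields.YangMills.Theorems.Prop7SymCentreAbelianFibre

open Literature.MathematicalPhysics.QuantumFieldTheory.Balaban1983to89
open Literature.MathematicalPhysics.QuantumFieldTheory.Balaban1983to89.T4Continuum
open Literature.MathematicalPhysics.QuantumFieldTheory.Balaban1983to89.T3ContinuumYM3Torus (T3Family)
open Literature.MathematicalPhysics.QuantumFieldTheory.Balaban1983to89.T3TiltDescent (descendTo)
open Literature.MathematicalPhysics.QuantumFieldTheory.Balaban1983to89.T3ConstrainedMinimiser (fibre)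
open Literature.MathematicalPhysics.QuantumFieldTheory.Balaban1983to89.T3PrintedRegularOrbits (sites_eq descTransf descendTo_gaugeAct)
open Literature.MathematicalPhysics.QuantumFieldTheory.Balaban1983to89.T3LevelShift (fieldShift bondShift fieldShift_apply)
open Literature.MathematicalPhysics.QuantumFieldTheory.Balaban1983to89.T3UnitLawDensityEML (ℰp)
open Literature.MathematicalPhysics.QuantumFieldTheory.Balaban1983to89.ExpMeanLog (expMeanLogSU deltaSU)
open Literature.MathematicalPhysics.QuantumFieldTheory.Balaban1983to89.B9AdOrthogonal (σ₃)
open Summit.QuantumFields.Balaban3D.Carriers (suGroupModel)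
open Summit.QuantumFields.YangMills.Theorems.BalabanUVNodesN08AlphaAbelianLift (gexp)
open Summit.QuantumFields.YangMills.Theorems.AbelianEML (gexpAt linAvgIter curlAt iter_blockAvg_gexpAt_region)
open Summit.QuantumFields.YangMills.Theorems.Prop7SymCentreAbelianDict (I_smul_sigma3_mem_lie)

/-! ## §1 Any `SU(N)`, any direction: the regional descent, pointwise -/

section General

variable (F : T3Family) {n K : ℕ} {N : ℕ} [NeZero N] {Y : Matrix (Fin N) (Fin N) ℂ} (hY : Y ∈ (suGroupModel N).lie)

/-- ★★ **THE DESCENT OF AN ABELIAN CONFIGURATION, POINTWISE UNDER A REGION**: for a nested family `R` of site sets of run `K` (`z ∈ R i ↔ blockOf z ∈ R (i+1)`, `i < K − n`), fine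
curls `≤ B` on the unit squares with four corners in `R 0` and the level thresholds for `s < K − n`, at every coarse bond `c` whose identified bond `ĉ = bondShift (sites_eq F n K h) c`
has both endpoints in `R (K − n)`: `descendTo F 𝓔 n K h (exp(a·Y)) c = exp((linAvgIter (K−n) a)(ĉ)·Y)` (★alpha-2 ✓`iter_blockAvg_gexpAt_region`). [cite: Balaban1987RG1, (0.4)+(0.11) p.253; Balaban1985Averaging, (19)-(20) p.21] -/
theorem descendTo_gexpAt_apply_of_region (hY0 : Y ≠ 0) (h : n ≤ K) (R : (i : ℕ) → Set (Site (F.P K) i))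
    (hR : ∀ i, i < K - n → ∀ z : Site (F.P K) i, z ∈ R i ↔ blockOf z ∈ R (i + 1))
    (a : PBond (F.P K) 0 → ℝ) {B : ℝ} (hB0 : 0 ≤ B)
    (hB : ∀ (x : Site (F.P K) 0) (μ ν : Fin (F.P K).d), μ ≠ ν → x ∈ R 0 → x.shift μ ∈ R 0 → x.shift ν ∈ R 0 → (x.shift μ).shift ν ∈ R 0 →
      |curlAt a x μ ν| ≤ B)
    (hthr : ∀ s, s < K - n → Real.pi / 2 * ((((((F.P K).d + 2) * (F.P K).L : ℕ) : ℝ) ^ 2 / 4) * ((((F.P K).L : ℝ) ^ 2) ^ s * B)) * ‖Y‖ <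
      min (deltaSU (Fin N)) (Real.log 2))
    (c : PBond (F.P n) 0) (hcs : (bondShift (sites_eq F n K h) c).src ∈ R (K - n)) (hct : (bondShift (sites_eq F n K h) c).tgt ∈ R (K - n)) :
    descendTo F (expMeanLogSU (n := Fin N)) n K h (gexpAt (suGroupModel N) hY a) c =
      gexpAt (suGroupModel N) hY (linAvgIter (K - n) a) (bondShift (sites_eq F n K h) c) := by
  have hk : K - n ≤ (F.P K).m + (F.P K).K := by show K - n ≤ F.m + K; omega
  have hreg := iter_blockAvg_gexpAt_region hY hY0 (K - n) hk R hR a hB0 hB hthr (K - n) le_rfl (bondShift (sites_eq F n K h) c) hcs hct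
  unfold descendTo
  rw [fieldShift_apply]
  exact hreg

/-- The regional form against a given coarse angle field: if moreover `linAvgIter (K−n) a (ĉ) = θ c` then `descendTo … (exp(a·Y)) c = exp(θ_c·Y)`. [cite: Balaban1987RG1, (0.11) p.253] -/
theorem descendTo_gexpAt_apply_eq_of_region (hY0 : Y ≠ 0) (h : n ≤ K) (R : (i : ℕ) → Set (Site (F.P K) i))
    (hR : ∀ i, i < K - n → ∀ z : Site (F.P K) i, z ∈ R i ↔ blockOf z ∈ R (i + 1))
    (a : PBond (F.P K) 0 → ℝ) {B : ℝ} (hB0 : 0 ≤ B)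
    (hB : ∀ (x : Site (F.P K) 0) (μ ν : Fin (F.P K).d), μ ≠ ν → x ∈ R 0 → x.shift μ ∈ R 0 → x.shift ν ∈ R 0 → (x.shift μ).shift ν ∈ R 0 →
      |curlAt a x μ ν| ≤ B)
    (hthr : ∀ s, s < K - n → Real.pi / 2 * ((((((F.P K).d + 2) * (F.P K).L : ℕ) : ℝ) ^ 2 / 4) * ((((F.P K).L : ℝ) ^ 2) ^ s * B)) * ‖Y‖ <
      min (deltaSU (Fin N)) (Real.log 2))
    (θ : PBond (F.P n) 0 → ℝ) (c : PBond (F.P n) 0) (hcs : (bondShift (sites_eq F n K h) c).src ∈ R (K - n))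
    (hct : (bondShift (sites_eq F n K h) c).tgt ∈ R (K - n)) (hθ : linAvgIter (K - n) a (bondShift (sites_eq F n K h) c) = θ c) :
    descendTo F (expMeanLogSU (n := Fin N)) n K h (gexpAt (suGroupModel N) hY a) c = gexpAt (suGroupModel N) hY θ c := by
  rw [descendTo_gexpAt_apply_of_region F hY hY0 h R hR a hB0 hB hthr c hcs hct]
  show gexp _ hY (linAvgIter (K - n) a (bondShift (sites_eq F n K h) c)) = gexp _ hY (θ c)
  rw [hθ]

/-- **Gauge-covariant regional form**: `descendTo (u • exp(a·Y)) c = u↓(c₋)·exp(θ_c·Y)·u↓(c₊)⁻¹` at the coarse bonds under the region (✓`descendTo_gaugeAct` + §1b) — the reading for a field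
that is abelian only up to a gauge `u` (string relocation ∕ re-gauging patches). [cite: Balaban1985Averaging, (11)-(12) p.19; Balaban1987RG1, (0.11) p.253] -/
theorem descendTo_gaugeAct_gexpAt_apply_eq_of_region (hY0 : Y ≠ 0) (h : n ≤ K) (R : (i : ℕ) → Set (Site (F.P K) i))
    (hR : ∀ i, i < K - n → ∀ z : Site (F.P K) i, z ∈ R i ↔ blockOf z ∈ R (i + 1))
    (a : PBond (F.P K) 0 → ℝ) {B : ℝ} (hB0 : 0 ≤ B)
    (hB : ∀ (x : Site (F.P K) 0) (μ ν : Fin (F.P K).d), μ ≠ ν → x ∈ R 0 → x.shift μ ∈ R 0 → x.shift ν ∈ R 0 → (x.shift μ).shift ν ∈ R 0 →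
      |curlAt a x μ ν| ≤ B)
    (hthr : ∀ s, s < K - n → Real.pi / 2 * ((((((F.P K).d + 2) * (F.P K).L : ℕ) : ℝ) ^ 2 / 4) * ((((F.P K).L : ℝ) ^ 2) ^ s * B)) * ‖Y‖ <
      min (deltaSU (Fin N)) (Real.log 2))
    (θ : PBond (F.P n) 0 → ℝ) (u : GaugeTransf (F.P K) 0 (Matrix.specialUnitaryGroup (Fin N) ℂ)) (c : PBond (F.P n) 0)
    (hcs : (bondShift (sites_eq F n K h) c).src ∈ R (K - n)) (hct : (bondShift (sites_eq F n K h) c).tgt ∈ R (K - n))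
    (hθ : linAvgIter (K - n) a (bondShift (sites_eq F n K h) c) = θ c) :
    descendTo F (expMeanLogSU (n := Fin N)) n K h (GaugeField.gaugeAct u (gexpAt (suGroupModel N) hY a)) c =
      GaugeField.gaugeAct (descTransf F n K h u) (gexpAt (suGroupModel N) hY θ) c := by
  rw [descendTo_gaugeAct]
  show descTransf F n K h u c.src * descendTo F _ n K h _ c * (descTransf F n K h u c.tgt)⁻¹ = descTransf F n K h u c.src * _ * (descTransf F n K h u c.tgt)⁻¹
  rw [descendTo_gexpAt_apply_eq_of_region F hY hY0 h R hR a hB0 hB hthr θ c hcs hct hθ]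

end General

/-! ## §2 T³ letters (`ℰp`, `SU(2)`, direction `iσ₃`, numeric window) -/

section T3

variable (F : T3Family) {n K : ℕ}

/-- ★★ **R4-FIBRE, REGIONAL (for the flux sector)**: for a finest real one-form `a` on run `K` whose curls are `≤ B` only on the unit squares with four corners in `R 0` (`R` nested up
to level `K − n`; e.g. off a neighbourhood of the Dirac strings of a flux cochain) and `30·L²·(L²)^{K−n}·B ≤ 1`: at every coarse bond `c` with `ĉ`'s endpoints in `R (K − n)`
and `linAvgIter (K−n) a (ĉ) = θ c`, `descendTo F ℰp n K h U_a c = V_θ c` (gauge-covariant form: §1b `descendTo_gaugeAct_gexpAt_apply_eq_of_region` + `curlGuard_of_window_T3`).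
[cite: Balaban1987RG1, (0.4)+(0.11) p.253; Balaban1985Averaging, (19)-(20) p.21] -/
theorem descendTo_diag_apply_eq_T3 (h : n ≤ K) (R : (i : ℕ) → Set (Site (F.P K) i))
    (hR : ∀ i, i < K - n → ∀ z : Site (F.P K) i, z ∈ R i ↔ blockOf z ∈ R (i + 1))
    (a : PBond (F.P K) 0 → ℝ) (θ : PBond (F.P n) 0 → ℝ) {B : ℝ} (hB0 : 0 ≤ B)
    (hB : ∀ (x : Site (F.P K) 0) (μ ν : Fin (F.P K).d), μ ≠ ν → x ∈ R 0 → x.shift μ ∈ R 0 → x.shift ν ∈ R 0 → (x.shift μ).shift ν ∈ R 0 →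
      |curlAt a x μ ν| ≤ B)
    (hwin : 30 * (F.L : ℝ) ^ 2 * ((((F.L : ℝ) ^ 2) ^ (K - n)) * B) ≤ 1)
    (c : PBond (F.P n) 0) (hcs : (bondShift (sites_eq F n K h) c).src ∈ R (K - n)) (hct : (bondShift (sites_eq F n K h) c).tgt ∈ R (K - n))
    (hθ : linAvgIter (K - n) a (bondShift (sites_eq F n K h) c) = θ c) :
    descendTo F ℰp n K h (gexpAt (suGroupModel 2) I_smul_sigma3_mem_lie a) c = gexpAt (suGroupModel 2) I_smul_sigma3_mem_lie θ c :=
  descendTo_gexpAt_apply_eq_of_region F I_smul_sigma3_mem_lie I_smul_sigma3_ne_zero h R hR a hB0 hB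
    (fun _ hs => curlGuard_of_window_T3 F hB0 hwin hs.le) θ c hcs hct hθ

/-- **R4-FIBRE, REGIONAL, gauge-covariant**: `descendTo F ℰp n K h (u • U_a) c = (u↓ • V_θ) c` at the coarse bonds under the region, for every fine gauge `u` (`u↓ = descTransf F n K h u`).
[cite: Balaban1985Averaging, (11)-(12) p.19; Balaban1987RG1, (0.4)+(0.11) p.253] -/
theorem descendTo_gaugeAct_diag_apply_eq_T3 (h : n ≤ K) (R : (i : ℕ) → Set (Site (F.P K) i))
    (hR : ∀ i, i < K - n → ∀ z : Site (F.P K) i, z ∈ R i ↔ blockOf z ∈ R (i + 1))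
    (a : PBond (F.P K) 0 → ℝ) (θ : PBond (F.P n) 0 → ℝ) {B : ℝ} (hB0 : 0 ≤ B)
    (hB : ∀ (x : Site (F.P K) 0) (μ ν : Fin (F.P K).d), μ ≠ ν → x ∈ R 0 → x.shift μ ∈ R 0 → x.shift ν ∈ R 0 → (x.shift μ).shift ν ∈ R 0 →
      |curlAt a x μ ν| ≤ B)
    (hwin : 30 * (F.L : ℝ) ^ 2 * ((((F.L : ℝ) ^ 2) ^ (K - n)) * B) ≤ 1)
    (u : GaugeTransf (F.P K) 0 (Matrix.specialUnitaryGroup (Fin 2) ℂ)) (c : PBond (F.P n) 0)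
    (hcs : (bondShift (sites_eq F n K h) c).src ∈ R (K - n)) (hct : (bondShift (sites_eq F n K h) c).tgt ∈ R (K - n))
    (hθ : linAvgIter (K - n) a (bondShift (sites_eq F n K h) c) = θ c) :
    descendTo F ℰp n K h (GaugeField.gaugeAct u (gexpAt (suGroupModel 2) I_smul_sigma3_mem_lie a)) c =
      GaugeField.gaugeAct (descTransf F n K h u) (gexpAt (suGroupModel 2) I_smul_sigma3_mem_lie θ) c :=
  descendTo_gaugeAct_gexpAt_apply_eq_of_region F I_smul_sigma3_mem_lie I_smul_sigma3_ne_zero h R hR a hB0 hB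
    (fun _ hs => curlGuard_of_window_T3 F hB0 hwin hs.le) θ u c hcs hct hθ

end T3

end Summit.QuantumFields.YangMills.Theorems.Prop7SymCentreAbelianFibre

end
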